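import Summits.RiemannHypothesis.RiemannHypothesis.Theorems.SemilocalLogAtomsE
import HarnessLib

/-!
# Log-atom enclosures (F): the atoms `73` and `81 = 3⁴`, and a lower bound of `log 83`

Cell `rh-explicit` (HOME `run/shared/lean/pub/rh-explicit/`), seat cc-s2-4 gen9 (A4 lane, the Lean side).  Sequel of
`SemilocalLogAtoms{,B,C,D,E}.lean`: the rational enclosures `(lo, hi, wlo, whi)` of `log n` and of the semilocal weight
`Λ(n)/√n` needed by the negative certificate of the wall `q = 79` (`S = {p ≤ 73}`, window `b < (log 83)/2`, the LAST prime
of the PROVABLE-NOW T2 q-table `q ≤ 73` (row `P = 79`), beyond every measured wall of the data lanes):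

* atom `73` (`log 73` to 11 decimals from `73 = 72·(1 + 1/72)`, `Real.abs_log_sub_add_sum_range_le`, 7 terms; `√73` by squaring),
* atom `81 = 3⁴` (exact: `4 log 3`, weight `log 3/9`),
* `logEightyThreeLo = 4·logThreeLo + 2/83 ≤ log 83` (from `log (83/81) ≥ 1 − 81/83`).

Folklore numerics throughout; nothing here bears on RH.
-/

set_option autoImplicit false
set_option linter.dupNamespace false  -- the mandated namespace repeats `RiemannHypothesis`

noncomputable section

namespace Summit.RiemannHypothesis.RiemannHypothesis.Theorems.SemilocalPolyWitness

open Real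
open Literature.NumberTheory.LFunctions
open Literature.Analysis.SpecialFunctions.Real
open Summit.RiemannHypothesis.RiemannHypothesis.Theorems.MotivicDoor.SemilocalMarkov

/-! ### The atom `73` (`log 73` from `73 = 72·(1 + 1/72)`) -/

/-- `(4.29045944095) < log 73` (`Real.abs_log_sub_add_sum_range_le` at `x = -1/72`, 7 terms). -/
theorem log_seventythree_gt : (4.29045944095 : ℝ) < Real.log 73 := by
  have t : |(-(1 : ℝ) / 72)| < 1 := by rw [abs_of_neg (by norm_num)]; norm_num
  have z := Real.abs_log_sub_add_sum_range_le t 7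
  rw [show |(-(1 : ℝ) / 72)| = 1 / 72 by rw [abs_of_neg (by norm_num)]; norm_num] at z
  norm_num [Finset.sum_range_succ] at z
  have e : Real.log (73 / 72) = Real.log 73 - (3 * Real.log 2 + 2 * Real.log 3) := by
    rw [Real.log_div (by norm_num) (by norm_num), show (72 : ℝ) = 2 ^ 3 * 3 ^ 2 by norm_num, Real.log_mul (by norm_num) (by norm_num), Real.log_pow, Real.log_pow]
    push_cast; ring
  rw [e] at z
  have h2 := Literature.Analysis.SpecialFunctions.Real.log_two_gt_d20
  have h3 := logThreeLo_le
  rw [logThreeLo] at h3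
  push_cast at h3
  obtain ⟨z1, z2⟩ := abs_le.1 z
  linarith

/-- `log 73 < 4.29045944136` (`Real.abs_log_sub_add_sum_range_le` at `x = -1/72`, 7 terms). -/
theorem log_seventythree_lt : Real.log 73 < 4.29045944136 := by
  have t : |(-(1 : ℝ) / 72)| < 1 := by rw [abs_of_neg (by norm_num)]; norm_num
  have z := Real.abs_log_sub_add_sum_range_le t 7
  rw [show |(-(1 : ℝ) / 72)| = 1 / 72 by rw [abs_of_neg (by norm_num)]; norm_num] at z
  norm_num [Finset.sum_range_succ] at z
  have e : Real.log (73 / 72) = Real.log 73 - (3 * Real.log 2 + 2 * Real.log 3) := by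
    rw [Real.log_div (by norm_num) (by norm_num), show (72 : ℝ) = 2 ^ 3 * 3 ^ 2 by norm_num, Real.log_mul (by norm_num) (by norm_num), Real.log_pow, Real.log_pow]
    push_cast; ring
  rw [e] at z
  have h2 := Literature.Analysis.SpecialFunctions.Real.log_two_lt_d20
  have h3 := log_three_le_logThreeHi
  rw [logThreeHi] at h3
  push_cast at h3
  obtain ⟨z1, z2⟩ := abs_le.1 z
  linarith

/-- lower decimal of `log 73` -/
def logSeventyThreeLo : ℚ := 429045944095 / 100000000000
/-- upper decimal of `log 73` -/
def logSeventyThreeHi : ℚ := 429045944136 / 100000000000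
/-- `logSeventyThreeLo ≤ log 73`. -/
theorem logSeventyThreeLo_le : (logSeventyThreeLo : ℝ) ≤ Real.log 73 := by
  rw [logSeventyThreeLo]; push_cast; linarith [log_seventythree_gt]
/-- `log 73 ≤ logSeventyThreeHi`. -/
theorem log_seventythree_le_logSeventyThreeHi : Real.log 73 ≤ (logSeventyThreeHi : ℝ) := by
  rw [logSeventyThreeHi]; push_cast; linarith [log_seventythree_lt]
/-- `8.5440037453175311 ≤ √73 ≤ 8.5440037453175312`. -/
def sqrtSeventyThreeLo : ℚ := 85440037453175311 / 10000000000000000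
/-- upper decimal of `√73` -/
def sqrtSeventyThreeHi : ℚ := 85440037453175312 / 10000000000000000
/-- The atom `73`: weight `log 73/√73`. -/
def atomSeventyThree : ℕ × AtomQ :=
  (73, ⟨logSeventyThreeLo, logSeventyThreeHi, logSeventyThreeLo / sqrtSeventyThreeHi, logSeventyThreeHi / sqrtSeventyThreeLo⟩)
/-- `atomSeventyThree` encloses the atom `73` for any `S ∋ 73`. -/
theorem atomSeventyThree_encl {S : Finset ℕ} (h : 73 ∈ S) :
    (atomSeventyThree.2.lo : ℝ) ≤ Real.log atomSeventyThree.1 ∧ Real.log atomSeventyThree.1 ≤ (atomSeventyThree.2.hi : ℝ) ∧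
      (atomSeventyThree.2.wlo : ℝ) ≤ weilSemilocalCoeff S atomSeventyThree.1 ∧
      weilSemilocalCoeff S atomSeventyThree.1 ≤ (atomSeventyThree.2.whi : ℝ) := by
  simp only [atomSeventyThree]
  push_cast
  have h0 := prime_atom_encl (by norm_num : Nat.Prime 73) h (lo := logSeventyThreeLo) (hi := logSeventyThreeHi)
    (slo := sqrtSeventyThreeLo) (shi := sqrtSeventyThreeHi) (by exact_mod_cast logSeventyThreeLo_le)
    (by exact_mod_cast log_seventythree_le_logSeventyThreeHi) (by rw [logSeventyThreeLo]; norm_num)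
    (ratCast_le_sqrt (by rw [sqrtSeventyThreeLo]; norm_num) (by rw [sqrtSeventyThreeLo]; norm_num))
    (sqrt_le_ratCast (by rw [sqrtSeventyThreeHi]; norm_num) (by rw [sqrtSeventyThreeHi]; norm_num))
    (by rw [sqrtSeventyThreeLo]; norm_num)
  push_cast at h0
  exact h0

/-! ### The atom `81 = 3⁴` -/

/-- The atom `81 = 3⁴`: `log 81 = 4 log 3`, weight `log 3/9`. -/
def atomEightyOne : ℕ × AtomQ := (81, ⟨4 * logThreeLo, 4 * logThreeHi, logThreeLo / 9, logThreeHi / 9⟩)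
/-- `atomEightyOne` encloses the atom `81` for any `S ∋ 3`. -/
theorem atomEightyOne_encl {S : Finset ℕ} (h : 3 ∈ S) :
    (atomEightyOne.2.lo : ℝ) ≤ Real.log atomEightyOne.1 ∧ Real.log atomEightyOne.1 ≤ (atomEightyOne.2.hi : ℝ) ∧
      (atomEightyOne.2.wlo : ℝ) ≤ weilSemilocalCoeff S atomEightyOne.1 ∧
      weilSemilocalCoeff S atomEightyOne.1 ≤ (atomEightyOne.2.whi : ℝ) := by
  simp only [atomEightyOne]
  rw [show (81 : ℕ) = 3 ^ 4 by norm_num]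
  have e81 : Real.sqrt ((3 ^ 4 : ℕ) : ℝ) = 9 := by
    rw [show ((3 ^ 4 : ℕ) : ℝ) = (9 : ℝ) ^ 2 by norm_num, Real.sqrt_sq (by norm_num)]
  have h0 := pow_atom_encl_of_bounds Nat.prime_three (by norm_num : (4 : ℕ) ≠ 0) h (lo := logThreeLo)
    (hi := logThreeHi) (slo := 9) (shi := 9) (by exact_mod_cast logThreeLo_le)
    (by exact_mod_cast log_three_le_logThreeHi) (by rw [logThreeLo]; norm_num) (by rw [e81]; norm_num)
    (by rw [e81]; norm_num) (by norm_num)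
  push_cast at h0 ⊢
  exact h0

/-! ### A lower bound of `log 83` (the window end of the wall `q = 79`) -/

/-- `4 * logThreeLo + 2/83 ≤ log 83`: `log 83 = log 81 + log (83/81) ≥ 4 log 3 + (1 − 81/83)`. -/
def logEightyThreeLo : ℚ := 4 * logThreeLo + 2 / 83
/-- `logEightyThreeLo ≤ log 83`. -/
theorem logEightyThreeLo_le : (logEightyThreeLo : ℝ) ≤ Real.log 83 := by
  have h81 : Real.log 81 = 4 * Real.log 3 := by
    rw [show (81 : ℝ) = 3 ^ 4 by norm_num, Real.log_pow]; push_cast; ring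
  have hq : Real.log 83 = 4 * Real.log 3 + Real.log (83 / 81) := by
    rw [← h81, ← Real.log_mul (by norm_num) (by norm_num)]
    norm_num
  have hlow : 1 - (83 / 81 : ℝ)⁻¹ ≤ Real.log (83 / 81) := Real.one_sub_inv_le_log_of_pos (by norm_num)
  have h3 := logThreeLo_le
  rw [logEightyThreeLo]
  push_cast
  rw [hq]
  norm_num at hlow ⊢
  linarith

/-! ## Appendix (cc-s2-4 gen10, 2026-08-24): users; the fine enclosure of `log 83`

Documentation only — no declaration is added or changed (this re-commit also lets the hub build drain pick the module up:
accepted 2026-08-23T15:53Z, never built; OPS-REQUESTS 2026-08-24T01:09Z).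

`atomSeventyThree`, `atomEightyOne` and `logEightyThreeLo` serve the wall rows `SemilocalNegCertUptoSeventyThree` (q = 79) and every
later wall (`…UptoSeventyNine` … `…UptoHundredTwentySeven`, q = 83 … 131).  The coarse `logEightyThreeLo = 4 log 3⁻ + 2/83` here is a
WINDOW-END bound only; the two-sided 10-decimal enclosure of `log 83` needed once `83` is an ATOM (walls q ≥ 89) is
`logEightyThreeLo11/Hi11` in `SemilocalLogAtomsH.lean`.
-/

end Summit.RiemannHypothesis.RiemannHypothesis.Theorems.SemilocalPolyWitness

end
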